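import Summits.QuantumFields.YangMills.Theorems.EquipartitionCriticalityEquipartitionPinsProbeTangentDefs
import Summits.QuantumFields.YangMills.Theorems.EquipartitionCriticalityEquipartitionPinsProbeTangentLieFrame
import Literature.Analysis.Calculus.ClosedSubgroupExpChart
import Summits.QuantumFields.YangMills.Theorems.EquipartitionCriticalityFreeEnergyLogCoefficientExpLipschitz
import HarnessLib

/-!
# `EquipartitionPinsProbe` (crux `stmt-QuantumFields-8760`), line `Sketch` — stub `stub_tangentDefect`

Route `EquipartitionCriticality` of `QuantumFields/YangMills`, crux
`Summit.QuantumFields.YangMills.Theses.EquipartitionCriticality.EquipartitionPinsProbe`, line `Sketch`,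
stub `stub_tangentDefect` (TB). For a lattice representation `r` of a compact group `G` and
`V = r.ρ g` the **tangent defect**

  `2 (N − Re tr V) − Σ_a (Re tr((V − 1) e_a†))²`

(the squared Frobenius distance `‖V − 1‖_F²` minus the squared length of the orthogonal projection
of `V − 1` onto the Lie algebra `𝔤_r`, in the orthonormal frame `e_a = lieVec r a`) is non-negative
and bounded by `K (N − Re tr V)²` uniformly in `g`.

Proof. `‖V − 1‖_F² = Re tr((V − 1)(V − 1)†) = 2 (N − Re tr V)` for unitary `V`
(`TangentTangentDefect.norm_sub_one_sq`); non-negativity is Bessel's inequality (`stub_lieFrame`).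
For every `X ∈ 𝔤_r` the defect is at most `‖V − 1 − X‖_F²` (expand `‖M − Σ c_a e_a‖²` for an
orthonormal family, `TangentTangentDefect.norm_sq_sub_sum_sq_le`, and `X = Σ_a lieCoord r X a • e_a`
by the completeness part of `stub_lieFrame`). Near `1`, von Neumann's exponential chart
(`exists_exp_chart_range`) writes `V = exp X` with `X ∈ 𝔤_r`, `‖X‖ ≤ 2‖V − 1‖ ≤ 1`, and the
second-order remainder `‖exp X − 1 − X‖ ≤ (e^{‖X‖} − 1)‖X‖ ≤ 2‖X‖²` (`norm_exp_sub_exp_sub_le`)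
gives the bound `256 (N − Re tr V)²`; away from `1` the defect is `≤ 2 (N − Re tr V)` with
`N − Re tr V ≥ s²/2`, whence `≤ (4/s²)(N − Re tr V)²`.

References: J. von Neumann, Math. Z. 30 (1929), §3; S. Chatterjee, arXiv:1602.01222, Lemma 11.2;
B. C. Hall, GTM 222 (2015), Thm. 3.20.
-/

noncomputable section

open scoped Matrix Matrix.Norms.Frobenius
open NormedSpace
open Literature.MathematicalPhysics.QuantumLattice Literature.MathematicalPhysics.QuantumFieldTheory

namespace Summit.QuantumFields.YangMills.Theorems.EquipartitionPinsProbe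

namespace TangentTangentDefect

/-- **Defect versus distance to the span**: for an orthonormal family `v` in a real inner product
space, `‖x‖² − Σ_i ⟪v_i, x⟫² ≤ ‖x − y‖²` for every `y = Σ_i c_i v_i` in the span (the left side is the
squared distance from `x` to the span; expand and complete the square `Σ_i (⟪v_i, x⟫ − c_i)² ≥ 0`). [folklore] -/
theorem norm_sq_sub_sum_sq_le {E ι : Type*} [NormedAddCommGroup E] [InnerProductSpace ℝ E]
    [Fintype ι] {v : ι → E} (hv : Orthonormal ℝ v) (x y : E) (c : ι → ℝ)
    (hy : y = ∑ i, c i • v i) :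
    ‖x‖ ^ 2 - ∑ i, (inner ℝ (v i) x) ^ 2 ≤ ‖x - y‖ ^ 2 := by
  have hxy : inner ℝ x y = ∑ i, c i * inner ℝ (v i) x := by
    rw [hy, inner_sum]
    exact Finset.sum_congr rfl fun i _ => by rw [real_inner_smul_right, real_inner_comm]
  have hyy : ‖y‖ ^ 2 = ∑ i, c i ^ 2 := by
    rw [← real_inner_self_eq_norm_sq, hy, hv.inner_sum]
    exact Finset.sum_congr rfl fun i _ => by rw [RCLike.conj_to_real, sq]
  have h0 : 0 ≤ ∑ i, (inner ℝ (v i) x - c i) ^ 2 := Finset.sum_nonneg fun i _ => sq_nonneg _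
  have hexp : ∑ i, (inner ℝ (v i) x - c i) ^ 2 =
      ∑ i, (inner ℝ (v i) x) ^ 2 - 2 * ∑ i, c i * inner ℝ (v i) x + ∑ i, c i ^ 2 := by
    simp only [sub_sq, Finset.sum_add_distrib, Finset.sum_sub_distrib, Finset.mul_sum]
    exact congrArg₂ (· + ·) (congrArg₂ (· - ·) rfl (Finset.sum_congr rfl fun i _ => by ring)) rfl
  rw [norm_sub_sq_real, hxy, hyy]
  linarith

/-- **Second-order remainder of the exponential**: `‖exp X − 1 − X‖ ≤ 2 ‖X‖²` for `‖X‖ ≤ 1` in a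
complete normed algebra (`‖exp X − 1 − X‖ ≤ (e^{‖X‖} − 1) ‖X‖` and `e^u − 1 ≤ 2u` on `[0, 1]`). [folklore] -/
theorem norm_exp_sub_one_sub_le {𝔸 : Type*} [NormedRing 𝔸] [NormedAlgebra ℝ 𝔸] [CompleteSpace 𝔸]
    {X : 𝔸} (hX : ‖X‖ ≤ 1) : ‖exp X - 1 - X‖ ≤ 2 * ‖X‖ ^ 2 := by
  have h := FreeEnergyLogCoefficient.norm_exp_sub_exp_sub_le (le_refl ‖X‖) (Y := 0)
    (by rw [norm_zero]; exact norm_nonneg X)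
  rw [exp_zero, sub_zero] at h
  have h2 : Real.exp ‖X‖ - 1 ≤ 2 * ‖X‖ := by
    have h3 := Real.abs_exp_sub_one_le (x := ‖X‖) (by rwa [abs_of_nonneg (norm_nonneg X)])
    rw [abs_of_nonneg (norm_nonneg X)] at h3
    exact (le_abs_self _).trans h3
  calc ‖exp X - 1 - X‖ ≤ (Real.exp ‖X‖ - 1) * ‖X‖ := h
    _ ≤ 2 * ‖X‖ * ‖X‖ := mul_le_mul_of_nonneg_right h2 (norm_nonneg X)
    _ = 2 * ‖X‖ ^ 2 := by ring

variable {G : Type} [Group G] [TopologicalSpace G] (r : LatticeRep G)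

/-- `‖ρ(g) − 1‖_F² = 2 (N − Re tr ρ(g))` for the unitary `ρ(g)`: `(V − 1)(V − 1)† = 2 − V − V†`. [folklore] -/
theorem norm_sub_one_sq (g : G) :
    ‖r.ρ g - 1‖ ^ 2 = 2 * ((r.N : ℝ) - (r.ρ g).trace.re) := by
  have hV : r.ρ g * (r.ρ g)ᴴ = 1 := by
    have h := Matrix.mem_unitaryGroup_iff.mp (r.mem_unitary g)
    rwa [Matrix.star_eq_conjTranspose] at h
  have h : (r.ρ g - 1) * (r.ρ g - 1)ᴴ = 1 + 1 - r.ρ g - (r.ρ g)ᴴ := by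
    rw [Matrix.conjTranspose_sub, Matrix.conjTranspose_one, sub_mul, mul_sub, mul_sub, one_mul,
      mul_one, one_mul, hV]
    abel
  rw [← TangentLieFrame.trace_mul_conjTranspose_re, h, Matrix.trace_sub, Matrix.trace_sub,
    Matrix.trace_add, Matrix.trace_one, Matrix.trace_conjTranspose, Fintype.card_fin]
  simp only [Complex.sub_re, Complex.add_re, Complex.star_def, Complex.conj_re, Complex.natCast_re]
  ring

end TangentTangentDefect

open TangentTangentDefect in
/-- **Stub `stub_tangentDefect` (TB)**: for a lattice representation `r` of a compact group there is
`K` such that for every `g`, with `V = r.ρ g` and the orthonormal frame `e_a = lieVec r a` of `𝔤_r`,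
`0 ≤ 2 (N − Re tr V) − Σ_a (Re tr((V − 1) e_a†))² ≤ K (N − Re tr V)²` — the deviation `V − 1` is
tangent to `𝔤_r` to second order (von Neumann's exponential chart plus `exp X − 1 − X = O(‖X‖²)`).
[cite: vonNeumann1929, §3] -/
theorem stub_tangentDefect :
    ∀ (G : Type) [Group G] [TopologicalSpace G] [CompactSpace G] (r : Literature.MathematicalPhysics.QuantumFieldTheory.LatticeRep G), ∃ K : ℝ,
      ∀ g : G,
        0 ≤ 2 * ((r.N : ℝ) - (r.ρ g).trace.re) - ∑ a : Fin (Summit.QuantumFields.YangMills.Theorems.EquipartitionPinsProbe.lieDim r), (Summit.QuantumFields.YangMills.Theorems.EquipartitionPinsProbe.lieCoord r (r.ρ g - 1) a) ^ 2 ∧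
        2 * ((r.N : ℝ) - (r.ρ g).trace.re) - ∑ a : Fin (Summit.QuantumFields.YangMills.Theorems.EquipartitionPinsProbe.lieDim r), (Summit.QuantumFields.YangMills.Theorems.EquipartitionPinsProbe.lieCoord r (r.ρ g - 1) a) ^ 2 ≤
          K * ((r.N : ℝ) - (r.ρ g).trace.re) ^ 2 := by
  intro G _ _ _ r
  -- the real Hilbert–Schmidt inner product `⟨A, B⟩ = Re tr(A† B)` on `M_N(ℂ)` (tree, a `def`)
  letI : InnerProductSpace ℝ (Matrix (Fin r.N) (Fin r.N) ℂ) := frobeniusInnerProductSpace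
  have hcoord : ∀ (M : Matrix (Fin r.N) (Fin r.N) ℂ) (a : Fin (lieDim r)),
      lieCoord r M a = inner ℝ (lieVec r a) M := fun M a => by
    rw [lieCoord, frobenius_inner_def, Matrix.trace_mul_comm]
  obtain ⟨horth, -, -, hcompl, hbessel⟩ := stub_lieFrame G r
  have hON : Orthonormal ℝ (lieVec r) := orthonormal_iff_ite.2 fun a b => by
    rw [← hcoord, horth b a]
    by_cases hab : a = b
    · rw [if_pos hab, if_pos hab.symm]
    · rw [if_neg hab, if_neg (Ne.symm hab)]
  -- von Neumann's chart radius
  obtain ⟨r₀, hr₀, hchart⟩ := Literature.Analysis.Calculus.exists_exp_chart_range r.ρ r.continuous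
  obtain ⟨s, hs0, hsr, hs2⟩ : ∃ s : ℝ, 0 < s ∧ s ≤ r₀ ∧ s ≤ 1 / 2 :=
    ⟨min r₀ (1 / 2), lt_min hr₀ one_half_pos, min_le_left _ _, min_le_right _ _⟩
  refine ⟨max 256 (4 / s ^ 2), fun g => ?_⟩
  have hnorm : ‖r.ρ g - 1‖ ^ 2 = 2 * ((r.N : ℝ) - (r.ρ g).trace.re) := norm_sub_one_sq r g
  have hbes : ∑ a, (lieCoord r (r.ρ g - 1) a) ^ 2 ≤ 2 * ((r.N : ℝ) - (r.ρ g).trace.re) := by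
    rw [← hnorm, ← TangentLieFrame.trace_mul_conjTranspose_re]
    exact hbessel _
  have hsum0 : 0 ≤ ∑ a, (lieCoord r (r.ρ g - 1) a) ^ 2 := Finset.sum_nonneg fun a _ => sq_nonneg _
  have hE0 : 0 ≤ (r.N : ℝ) - (r.ρ g).trace.re := by nlinarith [sq_nonneg ‖r.ρ g - 1‖]
  refine ⟨by linarith, ?_⟩
  by_cases hnear : ‖r.ρ g - 1‖ < s
  · -- near `1`: `V = exp X` with `X ∈ 𝔤_r`, `‖X‖ ≤ 2‖V − 1‖ ≤ 1`
    obtain ⟨X, hXgen, hXexp, hXle⟩ := hchart g (hnear.trans_le hsr)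
    have hX1 : ‖X‖ ≤ 1 := hXle.trans (by linarith)
    have hXmem : X ∈ Submodule.span ℝ {X : Matrix (Fin r.N) (Fin r.N) ℂ |
        ∀ t : ℝ, exp ((t : ℂ) • X) ∈ Set.range r.ρ} := by
      refine Submodule.subset_span fun t => ?_
      obtain ⟨k, hk⟩ := hXgen t
      exact ⟨k, hk⟩
    have key := norm_sq_sub_sum_sq_le hON (r.ρ g - 1) X (lieCoord r X)
      ((hcompl X hXmem).trans (Finset.sum_congr rfl fun a _ => rfl))
    simp_rw [← hcoord] at key
    have hdef : ‖r.ρ g - 1 - X‖ ≤ 16 * ((r.N : ℝ) - (r.ρ g).trace.re) :=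
      calc ‖r.ρ g - 1 - X‖ = ‖exp X - 1 - X‖ := by rw [hXexp]
        _ ≤ 2 * ‖X‖ ^ 2 := norm_exp_sub_one_sub_le hX1
        _ ≤ 2 * (2 * ‖r.ρ g - 1‖) ^ 2 := by gcongr
        _ = 16 * ((r.N : ℝ) - (r.ρ g).trace.re) := by rw [mul_pow, hnorm]; ring
    calc 2 * ((r.N : ℝ) - (r.ρ g).trace.re) - ∑ a, (lieCoord r (r.ρ g - 1) a) ^ 2
          = ‖r.ρ g - 1‖ ^ 2 - ∑ a, (lieCoord r (r.ρ g - 1) a) ^ 2 := by rw [hnorm]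
      _ ≤ ‖r.ρ g - 1 - X‖ ^ 2 := key
      _ ≤ (16 * ((r.N : ℝ) - (r.ρ g).trace.re)) ^ 2 := pow_le_pow_left₀ (norm_nonneg _) hdef 2
      _ = 256 * ((r.N : ℝ) - (r.ρ g).trace.re) ^ 2 := by ring
      _ ≤ max 256 (4 / s ^ 2) * ((r.N : ℝ) - (r.ρ g).trace.re) ^ 2 :=
          mul_le_mul_of_nonneg_right (le_max_left _ _) (sq_nonneg _)
  · -- away from `1`: the defect is `≤ 2E` and `E ≥ s²/2`
    have hsle : s ≤ ‖r.ρ g - 1‖ := not_lt.1 hnear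
    have hEs : s ^ 2 ≤ 2 * ((r.N : ℝ) - (r.ρ g).trace.re) := by
      rw [← hnorm]; exact pow_le_pow_left₀ hs0.le hsle 2
    have hs2pos : 0 < s ^ 2 := pow_pos hs0 2
    calc 2 * ((r.N : ℝ) - (r.ρ g).trace.re) - ∑ a, (lieCoord r (r.ρ g - 1) a) ^ 2
          ≤ 2 * ((r.N : ℝ) - (r.ρ g).trace.re) := by linarith
      _ ≤ 4 / s ^ 2 * ((r.N : ℝ) - (r.ρ g).trace.re) ^ 2 := by
          rw [div_mul_eq_mul_div, le_div_iff₀ hs2pos]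
          nlinarith
      _ ≤ max 256 (4 / s ^ 2) * ((r.N : ℝ) - (r.ρ g).trace.re) ^ 2 :=
          mul_le_mul_of_nonneg_right (le_max_right _ _) (sq_nonneg _)

end Summit.QuantumFields.YangMills.Theorems.EquipartitionPinsProbe

end
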